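import Summits.AtomisticToContinuum.Crystallization.Theorems.OverbindingBudgetAffineCompressedCutStackTwo

/-!
# Overbinding budget — compressed cut: R4 «LR(r₁)» I — THE STACK RUN (layer recursion with the class sequence)

Record: route `OverbindingBudget`, crux `RobustDefectLimitWindows` (stmt-AtomisticToContinuum-31280); open leaf NS♭₂ ⟸ 79K ⟸ LR(r₁);
chain of record R1 «ExactStep» ✓ → R2 «Establish» + «Seed» ✓ → R3 «Stack» ✓ → R4 «LR(r₁)» (critic rows 1428 (b), 1435 (B), 1437 (B)).

WHAT THIS FILE PROVES (potential-free, sorry-free; every bound symbolic; record constants `10⁻⁴`, `3/2 + 1/450`, `0.9967 / 1.0011` only).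
* §0 model-vector bookkeeping: `norm_mv_tadd_le`, `norm_mv_of_cap`, ★ `norm_mv_le_of_inLayer` (`6·‖mv x‖ ≤ lnorm x` on the layer lattice — the
  Euclidean length of an in-layer label is at most its hex distance), `thsum_tadd`, `thsum_of_inLayer`, `tsub_tadd_self`.
* §1 ★ `layer_climb_four` — `…StackTwo.layer_climb` for EACH of the four aligned copies `F⁺, F⁻, H, H′` and both sides `sg = ±1`, with the cap
  configuration, the in-layer row (KF / `kfNeg_fcc` / E1) and the two-parent rows (`up_*`) supplied from the kernel-decided tables: from a disc of hex
  radius `n + 1` uniformly charted onto `C ∈ {F⁺, F⁻, H, H′}`, SOME cap `c₀ ∈ capL C sg` carries an established disc of hex radius `n` in the adjacent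
  layer, every new site charted onto one of the four aligned copies.  ROOM is asked for every cap of `C` on side `sg` (so the statement does not
  depend on the table's choice of `c₀`).
* §2 ★★ `stack_run` — THE LAYER RECURSION: from a base disc (hex radius `n₀`, copy `C₀`, label `λ₀`, bounds `(τs 0, Ds 0)`, scales in
  `[νs 0, ν′s 0]`) and sequences `τs, Ds, νs, ν′s` dominating the one-layer increments of `layer_climb`, every level `m ≤ L` (`L ≤ n₀`) on side
  `sg` carries a disc of hex radius `n₀ − m`, uniformly charted onto ONE aligned copy `Cs m` (class recursion `…StackTwo.disc_uniform`), at labels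
  `lams m + x` with `lams (m+1) − lams m ∈ capL (Cs m) sg` (a STACK VECTOR: the class sequence of the memo), heights
  `thsum (lams m) = thsum λ₀ + 6·sg·m`, label norms `‖mv (lams m)‖ ≤ ‖mv λ₀‖ + m` — whence the UNIFORM ROOM condition
  `γ·(‖mv λ₀‖ + n₀) + Ds (m+1) ≤ r` (obligation ROOM of rows 1435/1437 reduced to one closed inequality per level).
  Side conditions per level (all symbolic; the record numerics are R4 II): the three resolution inequalities of `layer_climb`, ROOM, and the
  reach / resolution inequalities of `disc_uniform` at the new level.

Deps: `…CompressedCutStackTwo`.  No `instance`, no `notation`, no `set_option`, no new axioms, 0 sorry.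
-/

namespace Summit.AtomisticToContinuum.Crystallization.Theorems.OverbindingBudgetAffineCompressedCutRun

open Literature.Geometry.DiscreteGeometry (nearestDist nearestDist_nonneg fccTwoShellPattern hcpTwoShellPattern)
open Summit.AtomisticToContinuum.Crystallization.Theorems.OverbindingBudgetAffineCompressedCutKernel (T3 tsub tadd tsq thsum tdet fccL hcpL fccNegL
  hcpAltL hexL capL kernelOneB kernelTwoB mem_capL fccShellL kf_fcc e1_entries up_hcp_pos_fcc up_hcp_pos_hcp up_hcp_neg_fcc up_hcp_neg_hcp
  up_fcc_pos_fcc up_fcc_pos_hcp up_fcc_neg_fcc up_fcc_neg_hcp up_fccNeg_pos_fcc up_fccNeg_pos_hcp up_fccNeg_neg_fcc up_fccNeg_neg_hcp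
  up_hcpAlt_pos_fcc up_hcpAlt_pos_hcp up_hcpAlt_neg_fcc up_hcpAlt_neg_hcp)
open Summit.AtomisticToContinuum.Crystallization.Theorems.OverbindingBudgetAffineCompressedCutCharts (mv mv_tadd mv_tsub mv_zero norm_mv_eq_one_iff
  Carries ListedBy listedBy_fcc listedBy_hcp)
open Summit.AtomisticToContinuum.Crystallization.Theorems.OverbindingBudgetAffineCompressedCutEstablish (Estab link_nonneg)
open Summit.AtomisticToContinuum.Crystallization.Theorems.OverbindingBudgetAffineCompressedCutSeed (InLayer lnorm hexL_facts hex_descent estab_mono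
  inLayer_tsub inLayer_zero eq_zero_of_lnorm_le tadd_zero_right)
open Summit.AtomisticToContinuum.Crystallization.Theorems.OverbindingBudgetAffineCompressedCutStack (type_hcp_of_copy type_fcc_of_copy)
open Summit.AtomisticToContinuum.Crystallization.Theorems.OverbindingBudgetAffineCompressedCutStackTwo (layer_climb disc_uniform hexL_sub_shell kfNeg_fcc
  climb_hcp_up climb_hcp_down climb_fcc_up climb_fcc_down)

variable {N : ℕ}

/-! ## §0  Model-vector bookkeeping -/

/-- `‖mv (a + b)‖ ≤ ‖mv a‖ + ‖mv b‖`. [this file] -/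
theorem norm_mv_tadd_le (a b : T3) : ‖mv (tadd a b)‖ ≤ ‖mv a‖ + ‖mv b‖ := by
  rw [mv_tadd]; exact norm_add_le _ _

/-- A cap vector has model length `1`. [this file] -/
theorem norm_mv_of_cap {C : List T3} {s : ℤ} {c : T3} (hc : c ∈ capL C s) : ‖mv c‖ = 1 :=
  (norm_mv_eq_one_iff c).2 (mem_capL.1 hc).2.1

/-- ★ On the layer lattice the model length is at most the hex distance: `6·‖mv x‖ ≤ lnorm x` (induction along `hex_descent`). [this file] -/
theorem norm_mv_le_of_inLayer {x : T3} (hx : InLayer x) : 6 * ‖mv x‖ ≤ (lnorm x : ℝ) := by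
  suffices h : ∀ d : ℕ, ∀ x, InLayer x → lnorm x ≤ 6 * (d : ℤ) → 6 * ‖mv x‖ ≤ (lnorm x : ℝ) by
    obtain ⟨a, b, c⟩ := x
    refine h (Int.toNat (lnorm (a, b, c))) _ hx ?_
    have h0 : 0 ≤ lnorm (a, b, c) := by unfold lnorm; positivity
    rw [Int.toNat_of_nonneg h0]
    linarith
  intro d
  induction d with
  | zero =>
    intro x hx hl
    have hx0 : x = (0, 0, 0) := eq_zero_of_lnorm_le x (by simpa using hl)
    subst hx0
    rw [mv_zero, norm_zero, mul_zero]
    exact_mod_cast (by decide : (0 : ℤ) ≤ lnorm (0, 0, 0))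
  | succ d ih =>
    intro x hx hl
    by_cases hx0 : x = (0, 0, 0)
    · subst hx0
      rw [mv_zero, norm_zero, mul_zero]
      exact_mod_cast (by decide : (0 : ℤ) ≤ lnorm (0, 0, 0))
    obtain ⟨h, hh, hdesc⟩ := hex_descent hx hx0
    have hxh : InLayer (tsub x h) := inLayer_tsub hx (hexL_facts h hh).1
    have hl' : lnorm (tsub x h) ≤ 6 * (d : ℤ) := by push_cast at hl; linarith
    have ih' := ih (tsub x h) hxh hl'
    have hmh : ‖mv h‖ = 1 := (norm_mv_eq_one_iff h).2 (hexL_facts h hh).2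
    have hsplit : mv x = mv (tsub x h) + mv h := by rw [mv_tsub, sub_add_cancel]
    have htri : ‖mv x‖ ≤ ‖mv (tsub x h)‖ + ‖mv h‖ := by rw [hsplit]; exact norm_add_le _ _
    have hcast : ((lnorm x : ℤ) : ℝ) = (lnorm (tsub x h) : ℝ) + 6 := by exact_mod_cast hdesc.symm
    rw [hcast]
    linarith

/-- `thsum` is additive. [this file] -/
theorem thsum_tadd (a b : T3) : thsum (tadd a b) = thsum a + thsum b := by
  simp only [thsum, tadd]; ring

/-- In-layer vectors have height `0`. [this file] -/
theorem thsum_of_inLayer {x : T3} (hx : InLayer x) : thsum x = 0 := hx.1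

/-- `(a + c) − a = c`. [this file] -/
theorem tsub_tadd_self (a c : T3) : tsub (tadd a c) a = c := by
  obtain ⟨a₁, a₂, a₃⟩ := a
  obtain ⟨c₁, c₂, c₃⟩ := c
  simp only [tsub, tadd, Prod.mk.injEq]
  omega

/-- The four aligned copies, membership of the table outputs. [this file] -/
theorem mem_four_of_singleton {Q C : List T3} (hC : C ∈ [fccL, fccNegL, hcpL, hcpAltL]) (hQ : Q ∈ [C]) : Q ∈ [fccL, fccNegL, hcpL, hcpAltL] := by
  rw [List.mem_singleton] at hQ
  rw [hQ]; exact hC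

/-! ## §1  One layer up or down from any of the four aligned copies -/

/-- ★ **LAYER CLIMBING FROM ANY ALIGNED COPY.**  `…StackTwo.layer_climb` with the tables of the record: in-layer rows KF (`F⁺`), `kfNeg_fcc` (`F⁻`),
E1 (`H`, `H′`); cap configurations `F⁺↑/H↑ (3,3,0),(0,3,−3),(3,0,−3)`, `F⁺↓/H′↓ (−3,−3,0),(0,−3,3),(−3,0,3)`, `H↓/F⁻↓ (−1,−1,−4),(0,3,−3),(3,0,−3)`,
`F⁻↑/H′↑ (1,1,4),(0,−3,3),(−3,0,3)`; two-parent rows `up_*`.  Output: SOME cap `c₀ ∈ capL C sg` and the adjacent-layer disc at labels `λ₀ + c₀ + x`,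
every site charted onto one of the four aligned copies. [this file] -/
theorem layer_climb_four {y : Fin N → EuclideanSpace ℝ (Fin 3)} (hy : Function.Injective y) {r : ℝ} {i : Fin N}
    {A : Fin N → (EuclideanSpace ℝ (Fin 3) →ₗ[ℝ] EuclideanSpace ℝ (Fin 3))} {Qf : Fin N → (EuclideanSpace ℝ (Fin 3) →ₗᵢ[ℝ] EuclideanSpace ℝ (Fin 3))}
    {P : Fin N → Finset (EuclideanSpace ℝ (Fin 3))} {f : Fin N → EuclideanSpace ℝ (Fin 3) → EuclideanSpace ℝ (Fin 3)}
    {B : EuclideanSpace ℝ (Fin 3) →ₗ[ℝ] EuclideanSpace ℝ (Fin 3)} {β : ℝ}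
    (hP : ∀ j, dist (y j) (y i) ≤ r → (P j = fccTwoShellPattern ∨ P j = hcpTwoShellPattern))
    (hA : ∀ j, dist (y j) (y i) ≤ r → ∀ v ∈ P j, ‖A j v - Qf j v‖ ≤ 1 / 1000)
    (hf : ∀ j, dist (y j) (y i) ≤ r → ∀ v ∈ P j, f j v ∈ Set.range y ∧ dist (f j v) (y j + nearestDist y j • A j v) ≤ 1 / 10 ^ 4 * nearestDist y j)
    (hinj : ∀ j, dist (y j) (y i) ≤ r → Set.InjOn (f j) ↑(P j))
    (hex : ∀ j, dist (y j) (y i) ≤ r → ∀ m, m ≠ j → dist (y m) (y j) ≤ (3 / 2 + 1 / 450) * nearestDist y j → ∃ v ∈ P j, f j v = y m)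
    (hB : ∀ z, β * ‖z‖ ≤ ‖B z‖) {C : List T3} (hC : C ∈ [fccL, fccNegL, hcpL, hcpAltL]) {sg : ℤ} (hsg : sg = 1 ∨ sg = -1)
    {lam₀ : T3} {τ D ν ν' : ℝ} {n : ℕ}
    (hdisc : ∀ x, InLayer x → lnorm x ≤ 6 * ((n : ℤ) + 1) → ∃ k : Fin N, ∃ M : EuclideanSpace ℝ (Fin 3) →ₗᵢ[ℝ] EuclideanSpace ℝ (Fin 3),
      dist (y k) (y i) ≤ r ∧ ν ≤ nearestDist y k ∧ nearestDist y k ≤ ν' ∧ Estab y A P B i k M C (tadd lam₀ x) τ D)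
    (hΔ : 2 * D + 1 / 10 ^ 4 * ν' + τ < ν) (hsmall : (2 * τ + 5 / 2 * (3 / 10 ^ 4 * ν')) * Real.sqrt 2 < β)
    (hΔk : 2 * D + 2 / 10 ^ 4 * ν' + 2 * τ < 9967 / 10000 * ν)
    (hroom : ∀ c ∈ capL C sg, ∀ x, InLayer x → lnorm x ≤ 6 * (n : ℤ) → ‖B (mv (tadd (tadd lam₀ c) x))‖ + (D + 1 / 10 ^ 4 * ν' + τ) ≤ r) :
    ∃ c₀ ∈ capL C sg, ∀ x, InLayer x → lnorm x ≤ 6 * (n : ℤ) →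
      ∃ k : Fin N, ∃ M : EuclideanSpace ℝ (Fin 3) →ₗᵢ[ℝ] EuclideanSpace ℝ (Fin 3), ∃ Q : List T3,
        dist (y k) (y i) ≤ r ∧ 9967 / 10000 * ν ≤ nearestDist y k ∧ nearestDist y k ≤ 10011 / 10000 * ν' ∧ Q ∈ [fccL, fccNegL, hcpL, hcpAltL] ∧
        Estab y A P B i k M Q (tadd (tadd lam₀ c₀) x) (τ + 5 / 2 * (2 * (1 / 10 ^ 4) * ν' + 1 / 10 ^ 4 * (10011 / 10000 * ν')))
          (D + 1 / 10 ^ 4 * ν' + τ) := by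
  have four_f : fccL ∈ [fccL, fccNegL, hcpL, hcpAltL] := by simp
  have four_n : fccNegL ∈ [fccL, fccNegL, hcpL, hcpAltL] := by simp
  have four_h : hcpL ∈ [fccL, fccNegL, hcpL, hcpAltL] := by simp
  have four_a : hcpAltL ∈ [fccL, fccNegL, hcpL, hcpAltL] := by simp
  -- repackaging of a `layer_climb`-type conclusion
  have pack : ∀ {c₀ : T3} {Qa Qb : List T3}, c₀ ∈ capL C sg → Qa ∈ [fccL, fccNegL, hcpL, hcpAltL] → Qb ∈ [fccL, fccNegL, hcpL, hcpAltL] →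
      (∀ x, InLayer x → lnorm x ≤ 6 * (n : ℤ) → ∃ k : Fin N, ∃ M : EuclideanSpace ℝ (Fin 3) →ₗᵢ[ℝ] EuclideanSpace ℝ (Fin 3), ∃ Q : List T3,
        dist (y k) (y i) ≤ r ∧ 9967 / 10000 * ν ≤ nearestDist y k ∧ nearestDist y k ≤ 10011 / 10000 * ν' ∧
        ((P k = fccTwoShellPattern ∧ Q ∈ [Qa]) ∨ (P k = hcpTwoShellPattern ∧ Q ∈ [Qb])) ∧
        Estab y A P B i k M Q (tadd (tadd lam₀ c₀) x) (τ + 5 / 2 * (2 * (1 / 10 ^ 4) * ν' + 1 / 10 ^ 4 * (10011 / 10000 * ν')))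
          (D + 1 / 10 ^ 4 * ν' + τ)) →
      ∃ c₀ ∈ capL C sg, ∀ x, InLayer x → lnorm x ≤ 6 * (n : ℤ) →
        ∃ k : Fin N, ∃ M : EuclideanSpace ℝ (Fin 3) →ₗᵢ[ℝ] EuclideanSpace ℝ (Fin 3), ∃ Q : List T3,
          dist (y k) (y i) ≤ r ∧ 9967 / 10000 * ν ≤ nearestDist y k ∧ nearestDist y k ≤ 10011 / 10000 * ν' ∧ Q ∈ [fccL, fccNegL, hcpL, hcpAltL] ∧
          Estab y A P B i k M Q (tadd (tadd lam₀ c₀) x) (τ + 5 / 2 * (2 * (1 / 10 ^ 4) * ν' + 1 / 10 ^ 4 * (10011 / 10000 * ν')))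
            (D + 1 / 10 ^ 4 * ν' + τ) := by
    intro c₀ Qa Qb hc₀ hQa hQb h
    refine ⟨c₀, hc₀, fun x hx hl => ?_⟩
    obtain ⟨k, M, Q, h1, h2, h3, hQ, hE⟩ := h x hx hl
    refine ⟨k, M, Q, h1, h2, h3, ?_, hE⟩
    rcases hQ with ⟨-, hq⟩ | ⟨-, hq⟩
    · exact mem_four_of_singleton hQa hq
    · exact mem_four_of_singleton hQb hq
  simp only [List.mem_cons, List.not_mem_nil, or_false] at hC
  rcases hC with rfl | rfl | rfl | rfl
  · -- `F⁺`
    rcases hsg with rfl | rfl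
    · exact pack (by decide) four_f four_a (climb_fcc_up hy hP hA hf hinj hex hB hdisc hΔ hsmall hΔk (hroom (3, 3, 0) (by decide)))
    · exact pack (by decide) four_f four_h (climb_fcc_down hy hP hA hf hinj hex hB hdisc hΔ hsmall hΔk (hroom (-3, -3, 0) (by decide)))
  · -- `F⁻`
    have hT : ∀ k, dist (y k) (y i) ≤ r → ∀ (M : EuclideanSpace ℝ (Fin 3) →ₗᵢ[ℝ] EuclideanSpace ℝ (Fin 3)) (lam : T3) (τ D : ℝ),
        Estab y A P B i k M fccNegL lam τ D → ListedBy (P k) fccL :=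
      fun k hk M lam τ D hE => by rw [type_fcc_of_copy (hP k hk) (Or.inr rfl) hE.1]; exact listedBy_fcc
    rcases hsg with rfl | rfl
    · exact pack (by decide) four_n four_h
        (layer_climb hy hP hA hf hinj hex hB (C := fccNegL) (by simp) (S₁ := fccL) (Or.inl rfl) hT
          (xs := hexL) (fun h hh => hh) kfNeg_fcc (by simp) (sg := 1) (c₀ := (1, 1, 4)) (e₀ := (0, -3, 3)) (a₀ := (-3, 0, 3))
          (by decide) (by decide) (by decide) (by decide) (by decide) (by decide) (by decide)
          up_fccNeg_pos_fcc up_fccNeg_pos_hcp (by decide) (by decide) hdisc hΔ hsmall hΔk (hroom (1, 1, 4) (by decide)))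
    · exact pack (by decide) four_n four_a
        (layer_climb hy hP hA hf hinj hex hB (C := fccNegL) (by simp) (S₁ := fccL) (Or.inl rfl) hT
          (xs := hexL) (fun h hh => hh) kfNeg_fcc (by simp) (sg := -1) (c₀ := (-1, -1, -4)) (e₀ := (0, 3, -3)) (a₀ := (3, 0, -3))
          (by decide) (by decide) (by decide) (by decide) (by decide) (by decide) (by decide)
          up_fccNeg_neg_fcc up_fccNeg_neg_hcp (by decide) (by decide) hdisc hΔ hsmall hΔk (hroom (-1, -1, -4) (by decide)))
  · -- `H`
    rcases hsg with rfl | rfl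
    · exact pack (by decide) four_f four_a (climb_hcp_up hy hP hA hf hinj hex hB hdisc hΔ hsmall hΔk (hroom (3, 3, 0) (by decide)))
    · exact pack (by decide) four_n four_a (climb_hcp_down hy hP hA hf hinj hex hB hdisc hΔ hsmall hΔk (hroom (-1, -1, -4) (by decide)))
  · -- `H′`
    have hT : ∀ k, dist (y k) (y i) ≤ r → ∀ (M : EuclideanSpace ℝ (Fin 3) →ₗᵢ[ℝ] EuclideanSpace ℝ (Fin 3)) (lam : T3) (τ D : ℝ),
        Estab y A P B i k M hcpAltL lam τ D → ListedBy (P k) hcpL :=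
      fun k hk M lam τ D hE => by rw [type_hcp_of_copy (hP k hk) (Or.inr rfl) hE.1]; exact listedBy_hcp
    rcases hsg with rfl | rfl
    · exact pack (by decide) four_n four_h
        (layer_climb hy hP hA hf hinj hex hB (C := hcpAltL) (by simp) (S₁ := hcpL) (Or.inr rfl) hT
          (xs := hexL) (fun h hh => hh) e1_entries.2.2.2 (by simp) (sg := 1) (c₀ := (1, 1, 4)) (e₀ := (0, -3, 3)) (a₀ := (-3, 0, 3))
          (by decide) (by decide) (by decide) (by decide) (by decide) (by decide) (by decide)
          up_hcpAlt_pos_fcc up_hcpAlt_pos_hcp (by decide) (by decide) hdisc hΔ hsmall hΔk (hroom (1, 1, 4) (by decide)))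
    · exact pack (by decide) four_f four_h
        (layer_climb hy hP hA hf hinj hex hB (C := hcpAltL) (by simp) (S₁ := hcpL) (Or.inr rfl) hT
          (xs := hexL) (fun h hh => hh) e1_entries.2.2.2 (by simp) (sg := -1) (c₀ := (-3, -3, 0)) (e₀ := (0, -3, 3)) (a₀ := (-3, 0, 3))
          (by decide) (by decide) (by decide) (by decide) (by decide) (by decide) (by decide)
          up_hcpAlt_neg_fcc up_hcpAlt_neg_hcp (by decide) (by decide) hdisc hΔ hsmall hΔk (hroom (-3, -3, 0) (by decide)))

/-! ## §2  The stack run -/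

/-- ★★ **THE STACK RUN (layer recursion with the class sequence).**  See the module docstring.  The sequences `τs, Ds, νs, ν′s` are INPUTS
dominating the one-layer increments (`hτ`, `hD`, `hν`, `hν'`); the per-level side conditions are the three resolution inequalities of
`layer_climb` (`hΔ`, `hsmall`, `hΔk`), the UNIFORM ROOM inequality (`hroom`), and the reach / resolution inequalities of `disc_uniform` at the new
level (`hreach`, `hgap`).  Output: label and class sequences `lams, Cs` with `lams 0 = λ₀`, `Cs 0 = C₀`, stack-vector steps
`lams (m+1) − lams m ∈ capL (Cs m) sg`, heights, label norms, and at every level `m ≤ L` the disc of hex radius `n₀ − m` established on `Cs m`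
with bounds `(τs m, Ds m)` and scales in `[νs m, ν′s m]`. [this file] -/
theorem stack_run {y : Fin N → EuclideanSpace ℝ (Fin 3)} (hy : Function.Injective y) {r : ℝ} {i : Fin N}
    {A : Fin N → (EuclideanSpace ℝ (Fin 3) →ₗ[ℝ] EuclideanSpace ℝ (Fin 3))} {Qf : Fin N → (EuclideanSpace ℝ (Fin 3) →ₗᵢ[ℝ] EuclideanSpace ℝ (Fin 3))}
    {P : Fin N → Finset (EuclideanSpace ℝ (Fin 3))} {f : Fin N → EuclideanSpace ℝ (Fin 3) → EuclideanSpace ℝ (Fin 3)}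
    {B : EuclideanSpace ℝ (Fin 3) →ₗ[ℝ] EuclideanSpace ℝ (Fin 3)} {β γ : ℝ}
    (hP : ∀ j, dist (y j) (y i) ≤ r → (P j = fccTwoShellPattern ∨ P j = hcpTwoShellPattern))
    (hA : ∀ j, dist (y j) (y i) ≤ r → ∀ v ∈ P j, ‖A j v - Qf j v‖ ≤ 1 / 1000)
    (hf : ∀ j, dist (y j) (y i) ≤ r → ∀ v ∈ P j, f j v ∈ Set.range y ∧ dist (f j v) (y j + nearestDist y j • A j v) ≤ 1 / 10 ^ 4 * nearestDist y j)
    (hinj : ∀ j, dist (y j) (y i) ≤ r → Set.InjOn (f j) ↑(P j))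
    (hex : ∀ j, dist (y j) (y i) ≤ r → ∀ m, m ≠ j → dist (y m) (y j) ≤ (3 / 2 + 1 / 450) * nearestDist y j → ∃ v ∈ P j, f j v = y m)
    (hB : ∀ z, β * ‖z‖ ≤ ‖B z‖) (hβ : 0 < β) (hBup : ∀ z, ‖B z‖ ≤ γ * ‖z‖)
    {sg : ℤ} (hsg : sg = 1 ∨ sg = -1) {C₀ : List T3} (hC₀ : C₀ ∈ [fccL, fccNegL, hcpL, hcpAltL]) {lam₀ : T3}
    {τs Ds νs ν's : ℕ → ℝ} {n₀ L : ℕ} (hL : L ≤ n₀)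
    (hbase : ∀ x, InLayer x → lnorm x ≤ 6 * (n₀ : ℤ) → ∃ k : Fin N, ∃ M : EuclideanSpace ℝ (Fin 3) →ₗᵢ[ℝ] EuclideanSpace ℝ (Fin 3),
      dist (y k) (y i) ≤ r ∧ νs 0 ≤ nearestDist y k ∧ nearestDist y k ≤ ν's 0 ∧ Estab y A P B i k M C₀ (tadd lam₀ x) (τs 0) (Ds 0))
    (hτ : ∀ m, m < L → τs m + 5 / 2 * (2 * (1 / 10 ^ 4) * ν's m + 1 / 10 ^ 4 * (10011 / 10000 * ν's m)) ≤ τs (m + 1))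
    (hD : ∀ m, m < L → Ds m + 1 / 10 ^ 4 * ν's m + τs m ≤ Ds (m + 1))
    (hν : ∀ m, m < L → νs (m + 1) ≤ 9967 / 10000 * νs m) (hν' : ∀ m, m < L → 10011 / 10000 * ν's m ≤ ν's (m + 1))
    (hΔ : ∀ m, m < L → 2 * Ds m + 1 / 10 ^ 4 * ν's m + τs m < νs m)
    (hsmall : ∀ m, m < L → (2 * τs m + 5 / 2 * (3 / 10 ^ 4 * ν's m)) * Real.sqrt 2 < β)
    (hΔk : ∀ m, m < L → 2 * Ds m + 2 / 10 ^ 4 * ν's m + 2 * τs m < 9967 / 10000 * νs m)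
    (hroom : ∀ m, m < L → γ * (‖mv lam₀‖ + n₀) + (Ds m + 1 / 10 ^ 4 * ν's m + τs m) ≤ r)
    (hreach : ∀ m, m < L → γ + (Ds (m + 1) + 1 / 10 ^ 4 * ν's (m + 1) + τs (m + 1)) + Ds (m + 1) ≤ (3 / 2 + 1 / 450) * νs (m + 1))
    (hgap : ∀ m, m < L → 18 * ((Ds (m + 1) + 1 / 10 ^ 4 * ν's (m + 1) + τs (m + 1)) +
      (Ds (m + 1) + 1 / 10 ^ 4 * ν's (m + 1) + Real.sqrt 2 * τs (m + 1))) ^ 2 < 6 * β ^ 2) :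
    ∃ lams : ℕ → T3, ∃ Cs : ℕ → List T3, lams 0 = lam₀ ∧ Cs 0 = C₀ ∧
      (∀ m, m < L → tsub (lams (m + 1)) (lams m) ∈ capL (Cs m) sg) ∧
      ∀ m, m ≤ L → Cs m ∈ [fccL, fccNegL, hcpL, hcpAltL] ∧ thsum (lams m) = thsum lam₀ + 6 * sg * (m : ℤ) ∧
        ‖mv (lams m)‖ ≤ ‖mv lam₀‖ + m ∧
        ∀ x, InLayer x → lnorm x ≤ 6 * ((n₀ : ℤ) - (m : ℤ)) →
          ∃ k : Fin N, ∃ M : EuclideanSpace ℝ (Fin 3) →ₗᵢ[ℝ] EuclideanSpace ℝ (Fin 3),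
            dist (y k) (y i) ≤ r ∧ νs m ≤ nearestDist y k ∧ nearestDist y k ≤ ν's m ∧ Estab y A P B i k M (Cs m) (tadd (lams m) x) (τs m) (Ds m) := by
  have hγ : 0 ≤ γ := by
    have h1 : ‖mv (3, 0, -3)‖ = 1 := (norm_mv_eq_one_iff _).2 (by decide)
    have h := hBup (mv (3, 0, -3))
    rw [h1, mul_one] at h
    exact (norm_nonneg _).trans h
  -- induction on the number of climbs `L' ≤ L`
  suffices H : ∀ L', L' ≤ L → ∃ lams : ℕ → T3, ∃ Cs : ℕ → List T3, lams 0 = lam₀ ∧ Cs 0 = C₀ ∧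
      (∀ m, m < L' → tsub (lams (m + 1)) (lams m) ∈ capL (Cs m) sg) ∧
      ∀ m, m ≤ L' → Cs m ∈ [fccL, fccNegL, hcpL, hcpAltL] ∧ thsum (lams m) = thsum lam₀ + 6 * sg * (m : ℤ) ∧
        ‖mv (lams m)‖ ≤ ‖mv lam₀‖ + m ∧
        ∀ x, InLayer x → lnorm x ≤ 6 * ((n₀ : ℤ) - (m : ℤ)) →
          ∃ k : Fin N, ∃ M : EuclideanSpace ℝ (Fin 3) →ₗᵢ[ℝ] EuclideanSpace ℝ (Fin 3),
            dist (y k) (y i) ≤ r ∧ νs m ≤ nearestDist y k ∧ nearestDist y k ≤ ν's m ∧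
            Estab y A P B i k M (Cs m) (tadd (lams m) x) (τs m) (Ds m) from H L le_rfl
  intro L'
  induction L' with
  | zero =>
    intro _
    refine ⟨fun _ => lam₀, fun _ => C₀, rfl, rfl, fun m hm => absurd hm (Nat.not_lt_zero m), fun m hm => ?_⟩
    have hm0 : m = 0 := Nat.le_zero.1 hm
    subst hm0
    refine ⟨hC₀, by push_cast; ring, by push_cast; linarith, fun x hx hl => ?_⟩
    exact hbase x hx (by push_cast at hl; linarith)
  | succ L' ih =>
    intro hL'
    have hL'L : L' < L := hL'
    obtain ⟨lams, Cs, h0, hC0, hstep, hlev⟩ := ih hL'L.le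
    obtain ⟨hCL, hth, hnorm, hdiscL⟩ := hlev L' le_rfl
    -- the disc radius of the new level
    have hnle : L' + 1 ≤ n₀ := hL'.trans hL
    set n : ℕ := n₀ - (L' + 1) with hn
    have hncast : ((n : ℤ) + 1) = (n₀ : ℤ) - (L' : ℤ) := by omega
    have hnreal : (n : ℝ) + L' + 1 = n₀ := by
      have h : n + L' + 1 = n₀ := by omega
      exact_mod_cast h
    have hdisc' : ∀ x, InLayer x → lnorm x ≤ 6 * ((n : ℤ) + 1) → ∃ k : Fin N, ∃ M : EuclideanSpace ℝ (Fin 3) →ₗᵢ[ℝ] EuclideanSpace ℝ (Fin 3),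
        dist (y k) (y i) ≤ r ∧ νs L' ≤ nearestDist y k ∧ nearestDist y k ≤ ν's L' ∧ Estab y A P B i k M (Cs L') (tadd (lams L') x) (τs L') (Ds L') :=
      fun x hx hl => hdiscL x hx (by rw [← hncast]; exact hl)
    -- ROOM from the uniform inequality
    have hroom' : ∀ c ∈ capL (Cs L') sg, ∀ x, InLayer x → lnorm x ≤ 6 * (n : ℤ) →
        ‖B (mv (tadd (tadd (lams L') c) x))‖ + (Ds L' + 1 / 10 ^ 4 * ν's L' + τs L') ≤ r := by
      intro c hc x hx hl
      have h1 := hBup (mv (tadd (tadd (lams L') c) x))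
      have h2 : ‖mv (tadd (tadd (lams L') c) x)‖ ≤ ‖mv (lams L')‖ + ‖mv c‖ + ‖mv x‖ :=
        (norm_mv_tadd_le _ _).trans (by linarith [norm_mv_tadd_le (lams L') c])
      have h3 : ‖mv c‖ = 1 := norm_mv_of_cap hc
      have h4 : 6 * ‖mv x‖ ≤ (lnorm x : ℝ) := norm_mv_le_of_inLayer hx
      have h5 : (lnorm x : ℝ) ≤ 6 * (n : ℝ) := by exact_mod_cast hl
      have h6 : ‖mv (tadd (tadd (lams L') c) x)‖ ≤ ‖mv lam₀‖ + n₀ := by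
        rw [← hnreal]; linarith
      have h7 : γ * ‖mv (tadd (tadd (lams L') c) x)‖ ≤ γ * (‖mv lam₀‖ + n₀) := mul_le_mul_of_nonneg_left h6 hγ
      linarith [hroom L' hL'L]
    obtain ⟨c₀, hc₀, hnew⟩ := layer_climb_four hy hP hA hf hinj hex hB hCL hsg hdisc' (hΔ L' hL'L) (hsmall L' hL'L) (hΔk L' hL'L) hroom'
    -- conversion of the new disc to the level-(L'+1) parameters
    have hnew' : ∀ x, InLayer x → lnorm x ≤ 6 * (n : ℤ) → ∃ k : Fin N, ∃ M : EuclideanSpace ℝ (Fin 3) →ₗᵢ[ℝ] EuclideanSpace ℝ (Fin 3), ∃ Q : List T3,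
        dist (y k) (y i) ≤ r ∧ νs (L' + 1) ≤ nearestDist y k ∧ nearestDist y k ≤ ν's (L' + 1) ∧ Q ∈ [fccL, fccNegL, hcpL, hcpAltL] ∧
        Estab y A P B i k M Q (tadd (tadd (lams L') c₀) x) (τs (L' + 1)) (Ds (L' + 1)) := by
      intro x hx hl
      obtain ⟨k, M, Q, h1, h2, h3, hQ, hE⟩ := hnew x hx hl
      exact ⟨k, M, Q, h1, by linarith [hν L' hL'L], by linarith [hν' L' hL'L], hQ, estab_mono hE (hτ L' hL'L) (hD L' hL'L)⟩
    obtain ⟨C', hC', hunif⟩ := disc_uniform hP hf hex hB hβ hBup hnew' (hreach L' hL'L) (hgap L' hL'L)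
    -- the extended sequences
    refine ⟨fun m => if m ≤ L' then lams m else tadd (lams L') c₀, fun m => if m ≤ L' then Cs m else C', ?_, ?_, ?_, ?_⟩
    · dsimp only; rw [if_pos (Nat.zero_le _)]; exact h0
    · dsimp only; rw [if_pos (Nat.zero_le _)]; exact hC0
    · intro m hm
      dsimp only
      rcases Nat.lt_or_ge m L' with hlt | hge
      · rw [if_pos (Nat.succ_le_of_lt hlt), if_pos hlt.le, if_pos hlt.le]; exact hstep m hlt
      · have hmL : m = L' := le_antisymm (Nat.lt_succ_iff.1 hm) hge
        subst hmL
        rw [if_neg (Nat.not_succ_le_self m), if_pos le_rfl, if_pos le_rfl, tsub_tadd_self]; exact hc₀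
    · intro m hm
      dsimp only
      rcases Nat.lt_or_ge m (L' + 1) with hlt | hge
      · have hle : m ≤ L' := Nat.lt_succ_iff.1 hlt
        rw [if_pos hle, if_pos hle]
        exact hlev m hle
      · have hmL : m = L' + 1 := le_antisymm hm hge
        subst hmL
        rw [if_neg (Nat.not_succ_le_self L'), if_neg (Nat.not_succ_le_self L')]
        refine ⟨hC', ?_, ?_, fun x hx hl => ?_⟩
        · rw [thsum_tadd, hth, (mem_capL.1 hc₀).2.2]; push_cast; ring
        · have h1 := norm_mv_tadd_le (lams L') c₀
          rw [norm_mv_of_cap hc₀] at h1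
          push_cast; linarith
        · have hl' : lnorm x ≤ 6 * (n : ℤ) := by
            have h : (n : ℤ) = (n₀ : ℤ) - ((L' + 1 : ℕ) : ℤ) := by push_cast; omega
            rw [h]; exact hl
          exact hunif x hx hl'

end Summit.AtomisticToContinuum.Crystallization.Theorems.OverbindingBudgetAffineCompressedCutRun
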